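import Mathlib
import Summits.NavierStokesRegularity.NavierStokesRegularity.Theorems.FilamentSkeletonRssClause13ModelPiecesOperator
import Summits.NavierStokesRegularity.NavierStokesRegularity.Theorems.FilamentSkeletonRssClause13ModelBandEstimate

/-!
# Clause 13-J/13-R, brick n3 LAYER C (piece vs. operator in `L²`): `‖𝓛(k∗Y)‖₂ ≤ ‖k‖₁‖𝓛Y‖₂ + (Λ(‖t k′‖₁+‖k‖₁) + (L₁+L₂)‖t k‖₁)·‖Y‖₂`

Route `FilamentSkeletonRss`, ∃-side clause 13 (`Clause13RNearStraightL` stmt-NavierStokesRegularity-23612; typing-agnostic); design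
`filament-plan/DESIGN-28296-model-gluing-g16-v2-addendum.md` §C (task C1).  From the pointwise piece–operator identity (`pieceOperator_eq`, p700576) and
the commutator bounds (p693953) the `L²` size of `𝓛` on a cut-off piece is controlled by `𝓛Y` and `Y`:

* §1 an `L²` toolkit on `N(f) := (∫‖f‖²)^{1/2}`: `l2_add_le` (Minkowski for `MemLp` functions), `l2_sub_le`, `l2_eq_of_eq`;
* §2 `l2_kernel_mul_le` — `N(k∗F) ≤ ‖k‖₁·N(F)` for continuous bounded `F ∈ L²` (Schur–Young p693953);
* §3 `continuous_modelOperator` / `memLp_modelOperator` — `𝓛Y` is continuous, bounded and in `L²` for `Y ∈ C¹_c`, continuous `w, β₁, β₂`;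
* §4 `l2_pieceOperator_le` — **the estimate of the title** (k real `C¹`, bounded, `k, t k, t k′ ∈ L¹`; `Y ∈ C¹_c`; `w` differentiable, `|w′| ≤ Λ`;
  `β_i` continuous, `‖β_i‖ ≤ b_i`, `‖β_i(y) − β_i(x)‖ ≤ L_i|y−x|`).
Lane ns-filament-19175-p1 g16; `--supports stmt-NavierStokesRegularity-23612 --as helper`.
HONEST FRAMING: bookkeeping about an explicit 1-D model operator attached to a HYPOTHETICAL filament skeleton on the NEGATIVE side of a MODEL route;
nothing here bears on Navier–Stokes regularity or blow-up.
-/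

noncomputable section

open MeasureTheory Real Complex Filter Set
open scoped ComplexConjugate Topology ENNReal

namespace Summit.NavierStokesRegularity.NavierStokesRegularity.Theorems.MatchedKernel
set_option linter.dupNamespace false

/-! ## §1 `L²` toolkit -/

/-- `eLpNorm f 2 = ofReal ((∫‖f‖²)^{1/2})` for `f ∈ L²`. [folklore] -/
theorem eLpNorm_two_eq_ofReal {f : ℝ → ℂ} (hf : MemLp f 2 volume) :
    eLpNorm f 2 volume = ENNReal.ofReal ((∫ x, ‖f x‖ ^ 2) ^ (1 / 2 : ℝ)) := by
  rw [hf.eLpNorm_eq_integral_rpow_norm (by norm_num) (by norm_num)]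
  simp only [ENNReal.toReal_ofNat, Real.rpow_two, one_div]

/-- **Minkowski** in the `(∫‖·‖²)^{1/2}` notation. [folklore] -/
theorem l2_add_le {f g : ℝ → ℂ} (hf : MemLp f 2 volume) (hg : MemLp g 2 volume) :
    (∫ x, ‖f x + g x‖ ^ 2) ^ (1 / 2 : ℝ) ≤ (∫ x, ‖f x‖ ^ 2) ^ (1 / 2 : ℝ) + (∫ x, ‖g x‖ ^ 2) ^ (1 / 2 : ℝ) := by
  have h := eLpNorm_add_le hf.1 hg.1 (p := 2) (by norm_num)
  have hfg : MemLp (f + g) 2 volume := hf.add hg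
  rw [eLpNorm_two_eq_ofReal hf, eLpNorm_two_eq_ofReal hg, ← ENNReal.ofReal_add (by positivity) (by positivity)] at h
  have e : eLpNorm (f + g) 2 volume = ENNReal.ofReal ((∫ x, ‖f x + g x‖ ^ 2) ^ (1 / 2 : ℝ)) := eLpNorm_two_eq_ofReal hfg
  rw [e] at h
  exact (ENNReal.ofReal_le_ofReal_iff (by positivity)).1 h

/-- Minkowski for a difference. [folklore] -/
theorem l2_sub_le {f g : ℝ → ℂ} (hf : MemLp f 2 volume) (hg : MemLp g 2 volume) :
    (∫ x, ‖f x - g x‖ ^ 2) ^ (1 / 2 : ℝ) ≤ (∫ x, ‖f x‖ ^ 2) ^ (1 / 2 : ℝ) + (∫ x, ‖g x‖ ^ 2) ^ (1 / 2 : ℝ) := by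
  have h := l2_add_le hf hg.neg
  simp only [Pi.neg_apply, norm_neg, ← sub_eq_add_neg] at h
  exact h

/-- From a bound `∫‖g‖² ≤ M²·∫‖f‖²` with `M ≥ 0` to `N(g) ≤ M·N(f)`. [folklore] -/
theorem l2_le_of_sq_le {f g : ℝ → ℂ} {M : ℝ} (hM : 0 ≤ M) (h : ∫ x, ‖g x‖ ^ 2 ≤ M ^ 2 * ∫ x, ‖f x‖ ^ 2) :
    (∫ x, ‖g x‖ ^ 2) ^ (1 / 2 : ℝ) ≤ M * (∫ x, ‖f x‖ ^ 2) ^ (1 / 2 : ℝ) := by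
  have h0 : 0 ≤ ∫ x, ‖f x‖ ^ 2 := integral_nonneg fun x => by positivity
  have h1 : 0 ≤ ∫ x, ‖g x‖ ^ 2 := integral_nonneg fun x => by positivity
  calc (∫ x, ‖g x‖ ^ 2) ^ (1 / 2 : ℝ) ≤ (M ^ 2 * ∫ x, ‖f x‖ ^ 2) ^ (1 / 2 : ℝ) := Real.rpow_le_rpow h1 h (by norm_num)
    _ = M * (∫ x, ‖f x‖ ^ 2) ^ (1 / 2 : ℝ) := by
        rw [Real.mul_rpow (by positivity) h0, show (M ^ 2) ^ (1 / 2 : ℝ) = M by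
          rw [← Real.sqrt_eq_rpow, Real.sqrt_sq hM]]

/-! ## §2 `N(k∗F) ≤ ‖k‖₁ N(F)` for continuous bounded `F ∈ L²` -/

/-- For `k ∈ L¹` continuous and `F` continuous, bounded, in `L²`: `(∫‖∫k(x−y)F(y)dy‖²)^{1/2} ≤ ‖k‖₁·(∫‖F‖²)^{1/2}`, and the convolution is in
`L²`. [folklore] -/
theorem l2_kernel_mul_le {k : ℝ → ℝ} (hkc : Continuous k) (hki : Integrable k) {F : ℝ → ℂ} (hFc : Continuous F) (hF2 : MemLp F 2 volume)
    {MF : ℝ} (hFb : ∀ y, ‖F y‖ ≤ MF) :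
    MemLp (fun x : ℝ => ∫ y : ℝ, ((k (x - y) : ℝ) : ℂ) * F y) 2 volume ∧
      (∫ x : ℝ, ‖∫ y : ℝ, ((k (x - y) : ℝ) : ℂ) * F y‖ ^ 2) ^ (1 / 2 : ℝ) ≤ (∫ t, |k t|) * (∫ y : ℝ, ‖F y‖ ^ 2) ^ (1 / 2 : ℝ) := by
  -- measurability via the product
  have hP : Continuous fun p : ℝ × ℝ => ((k (p.1 - p.2) : ℝ) : ℂ) * F p.2 :=
    (Complex.continuous_ofReal.comp (hkc.comp (continuous_fst.sub continuous_snd))).mul (hFc.comp continuous_snd)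
  have hg : AEStronglyMeasurable (fun x : ℝ => ∫ y : ℝ, ((k (x - y) : ℝ) : ℂ) * F y) volume :=
    (hP.aestronglyMeasurable (μ := (volume : Measure ℝ).prod volume)).integral_prod_right'
  -- pointwise domination (the integrand is integrable: `k(x−·) ∈ L¹`, `F` bounded)
  have hdom : ∀ᵐ x ∂volume, ‖∫ y : ℝ, ((k (x - y) : ℝ) : ℂ) * F y‖ ≤ ∫ y, (fun t => |k t|) (x - y) * ‖F y‖ := by
    refine ae_of_all _ fun x => ?_
    have hint : Integrable (fun y : ℝ => |k (x - y)| * ‖F y‖) := by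
      have h1 : Integrable (fun y : ℝ => |k (x - y)|) := (hki.comp_sub_left x).abs
      refine (h1.bdd_mul hFc.norm.aestronglyMeasurable (c := MF) (ae_of_all _ fun y => ?_)).congr
        (ae_of_all _ fun y => by simp only [mul_comm])
      rw [Real.norm_eq_abs, abs_of_nonneg (norm_nonneg _)]; exact hFb y
    refine norm_integral_le_of_norm_le hint (ae_of_all _ fun y => ?_)
    rw [norm_mul, Complex.norm_real, Real.norm_eq_abs]
  obtain ⟨hLp, hle⟩ := integral_sq_norm_le_of_norm_le_integral_mul hki.abs hF2 hg hdom
  refine ⟨hLp, l2_le_of_sq_le (integral_nonneg fun t => abs_nonneg _) ?_⟩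
  simpa only [abs_abs] using hle

/-! ## §3 The model operator on a `C¹_c` variation is continuous, bounded and in `L²` -/

/-- `𝓛Y` is continuous for `Y ∈ C¹_c` and continuous `w, β₁, β₂`. [folklore] -/
theorem continuous_modelOperator {q : ℝ} (hq : 0 < q) (G : ℝ) {Y : ℝ → ℂ} (hY : ContDiff ℝ 1 Y) (hYs : HasCompactSupport Y)
    {w : ℝ → ℝ} (hwc : Continuous w) {β₁ β₂ : ℝ → ℂ} (hβ₁c : Continuous β₁) (hβ₂c : Continuous β₂) :
    Continuous fun τ : ℝ => I * (G : ℂ) * ((2 / q : ℂ) * Y τ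
        - ∫ σ : ℝ, ((((2 * q - (τ - σ) ^ 2) * (((τ - σ) ^ 2 + q) ^ (5 / 2 : ℝ))⁻¹ : ℝ)) : ℂ) * Y σ)
      - ((w τ : ℝ) : ℂ) * deriv Y τ + β₁ τ * Y τ + β₂ τ * conj (Y τ) := by
  have hYc := hY.continuous
  have hY'c : Continuous (deriv Y) := hY.continuous_deriv le_rfl
  have hK := continuous_smoothingPiece hq hYc hYs
  exact (((continuous_const.mul ((continuous_const.mul hYc).sub hK)).sub ((Complex.continuous_ofReal.comp hwc).mul hY'c)).add
    (hβ₁c.mul hYc)).add (hβ₂c.mul (Complex.continuous_conj.comp hYc))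

/-- `𝓛Y` is bounded. [folklore] -/
theorem exists_bound_modelOperator {q : ℝ} (hq : 0 < q) (G : ℝ) {Y : ℝ → ℂ} (hY : ContDiff ℝ 1 Y) (hYs : HasCompactSupport Y)
    {w : ℝ → ℝ} (hwc : Continuous w) {β₁ β₂ : ℝ → ℂ} (hβ₁c : Continuous β₁) (hβ₂c : Continuous β₂) :
    ∃ M : ℝ, ∀ τ : ℝ, ‖I * (G : ℂ) * ((2 / q : ℂ) * Y τ
        - ∫ σ : ℝ, ((((2 * q - (τ - σ) ^ 2) * (((τ - σ) ^ 2 + q) ^ (5 / 2 : ℝ))⁻¹ : ℝ)) : ℂ) * Y σ)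
      - ((w τ : ℝ) : ℂ) * deriv Y τ + β₁ τ * Y τ + β₂ τ * conj (Y τ)‖ ≤ M := by
  have hYc := hY.continuous
  have hY'c : Continuous (deriv Y) := hY.continuous_deriv le_rfl
  -- the compactly supported part
  set C : ℝ → ℂ := fun τ => I * (G : ℂ) * ((2 / q : ℂ) * Y τ) - ((w τ : ℝ) : ℂ) * deriv Y τ + β₁ τ * Y τ + β₂ τ * conj (Y τ) with hC
  have hCc : Continuous C := (((continuous_const.mul (continuous_const.mul hYc)).sub ((Complex.continuous_ofReal.comp hwc).mul hY'c)).add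
    (hβ₁c.mul hYc)).add (hβ₂c.mul (Complex.continuous_conj.comp hYc))
  have hCs : HasCompactSupport C := by
    refine (((hYs.mul_left.mul_left).sub hYs.deriv.mul_left).add hYs.mul_left).add ?_
    exact (hYs.comp_left (g := conj) (map_zero _)).mul_left
  obtain ⟨MC, hMC⟩ := hCc.bounded_above_of_compact_support hCs
  refine ⟨MC + ‖I * (G : ℂ)‖ * (2 * (q ^ (3 / 2 : ℝ))⁻¹ * ∫ σ : ℝ, ‖Y σ‖), fun τ => ?_⟩
  have hK := norm_smoothingPiece_le hq hYc hYs τ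
  have e : I * (G : ℂ) * ((2 / q : ℂ) * Y τ
        - ∫ σ : ℝ, ((((2 * q - (τ - σ) ^ 2) * (((τ - σ) ^ 2 + q) ^ (5 / 2 : ℝ))⁻¹ : ℝ)) : ℂ) * Y σ)
      - ((w τ : ℝ) : ℂ) * deriv Y τ + β₁ τ * Y τ + β₂ τ * conj (Y τ)
      = C τ - I * (G : ℂ) * ∫ σ : ℝ, ((((2 * q - (τ - σ) ^ 2) * (((τ - σ) ^ 2 + q) ^ (5 / 2 : ℝ))⁻¹ : ℝ)) : ℂ) * Y σ := by
    simp only [hC]; ring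
  rw [e]
  calc ‖C τ - I * (G : ℂ) * ∫ σ : ℝ, ((((2 * q - (τ - σ) ^ 2) * (((τ - σ) ^ 2 + q) ^ (5 / 2 : ℝ))⁻¹ : ℝ)) : ℂ) * Y σ‖
      ≤ ‖C τ‖ + ‖I * (G : ℂ) * ∫ σ : ℝ, ((((2 * q - (τ - σ) ^ 2) * (((τ - σ) ^ 2 + q) ^ (5 / 2 : ℝ))⁻¹ : ℝ)) : ℂ) * Y σ‖ := norm_sub_le _ _
    _ ≤ MC + ‖I * (G : ℂ)‖ * (2 * (q ^ (3 / 2 : ℝ))⁻¹ * ∫ σ : ℝ, ‖Y σ‖) := by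
        rw [norm_mul]; gcongr; exact hMC τ

/-- `𝓛Y ∈ L²`. [folklore] -/
theorem memLp_modelOperator {q : ℝ} (hq : 0 < q) (G : ℝ) {Y : ℝ → ℂ} (hY : ContDiff ℝ 1 Y) (hYs : HasCompactSupport Y)
    {w : ℝ → ℝ} (hwc : Continuous w) {β₁ β₂ : ℝ → ℂ} (hβ₁c : Continuous β₁) (hβ₂c : Continuous β₂) {b₁ b₂ : ℝ}
    (hb₁ : ∀ τ, ‖β₁ τ‖ ≤ b₁) (hb₂ : ∀ τ, ‖β₂ τ‖ ≤ b₂) :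
    MemLp (fun τ : ℝ => I * (G : ℂ) * ((2 / q : ℂ) * Y τ
        - ∫ σ : ℝ, ((((2 * q - (τ - σ) ^ 2) * (((τ - σ) ^ 2 + q) ^ (5 / 2 : ℝ))⁻¹ : ℝ)) : ℂ) * Y σ)
      - ((w τ : ℝ) : ℂ) * deriv Y τ + β₁ τ * Y τ + β₂ τ * conj (Y τ)) 2 volume := by
  have hYc := hY.continuous
  have hY'c : Continuous (deriv Y) := hY.continuous_deriv le_rfl
  have hY2 : MemLp Y 2 volume := hYc.memLp_of_hasCompactSupport hYs
  have hK2 := memLp_piece (k := fun s => (2 * q - s ^ 2) * ((s ^ 2 + q) ^ (5 / 2 : ℝ))⁻¹) (continuous_smoothingKernel hq)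
    (integrable_smoothingKernel_real hq) hYc hYs
  have hS : MemLp (fun τ : ℝ => I * (G : ℂ) * ((2 / q : ℂ) * Y τ
      - ∫ σ : ℝ, ((((2 * q - (τ - σ) ^ 2) * (((τ - σ) ^ 2 + q) ^ (5 / 2 : ℝ))⁻¹ : ℝ)) : ℂ) * Y σ)) 2 volume :=
    ((hY2.const_mul _).sub hK2).const_mul _
  have hT : MemLp (fun τ : ℝ => ((w τ : ℝ) : ℂ) * deriv Y τ) 2 volume :=
    ((Complex.continuous_ofReal.comp hwc).mul hY'c).memLp_of_hasCompactSupport hYs.deriv.mul_left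
  have hB1 : MemLp (fun τ : ℝ => β₁ τ * Y τ) 2 volume := memLp_boundedMultiplier_mul hβ₁c.aestronglyMeasurable hb₁ hY2
  have hB2 : MemLp (fun τ : ℝ => β₂ τ * conj (Y τ)) 2 volume := memLp_boundedMultiplier_mul hβ₂c.aestronglyMeasurable hb₂ (memLp_conj hY2)
  exact ((hS.sub hT).add hB1).add hB2

/-! ## §4 The `L²` estimate of `𝓛` on a piece -/

/-- **`‖𝓛(k∗Y)‖₂ ≤ ‖k‖₁‖𝓛Y‖₂ + (Λ(‖t k′‖₁ + ‖k‖₁) + (L₁ + L₂)‖t k‖₁)‖Y‖₂`** for the full 1-D model operator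
`𝓛f = iG((2/q)f − K_q∗f) − w f′ + β₁f + β₂conj f`, a real `C¹` bounded kernel with `k, t k, t k′ ∈ L¹`, `Y ∈ C¹_c`, a differentiable slip with
`|w′| ≤ Λ`, and continuous multipliers with `‖β_i‖ ≤ b_i`, `‖β_i(y) − β_i(x)‖ ≤ L_i|y − x|`. [folklore] -/
theorem l2_pieceOperator_le {q G : ℝ} (hq : 0 < q) {k k' : ℝ → ℝ} (hk : ∀ t, HasDerivAt k (k' t) t) (hk'c : Continuous k')
    (hki : Integrable k) (hk1 : Integrable fun t => t * k t) (hk'1 : Integrable fun t => t * k' t) {Mk : ℝ} (hkM : ∀ t, |k t| ≤ Mk)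
    {Y : ℝ → ℂ} (hY : ContDiff ℝ 1 Y) (hYs : HasCompactSupport Y)
    {w : ℝ → ℝ} (hw : Differentiable ℝ w) {Λ : ℝ} (hΛ : ∀ t, |deriv w t| ≤ Λ)
    {β₁ β₂ : ℝ → ℂ} (hβ₁c : Continuous β₁) (hβ₂c : Continuous β₂) {b₁ b₂ L₁ L₂ : ℝ}
    (hb₁ : ∀ τ, ‖β₁ τ‖ ≤ b₁) (hb₂ : ∀ τ, ‖β₂ τ‖ ≤ b₂) (hL₁ : ∀ x y, ‖β₁ y - β₁ x‖ ≤ L₁ * |y - x|) (hL₂ : ∀ x y, ‖β₂ y - β₂ x‖ ≤ L₂ * |y - x|) :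
    (∫ x : ℝ, ‖I * (G : ℂ) * ((2 / q : ℂ) * (∫ y : ℝ, ((k (x - y) : ℝ) : ℂ) * Y y)
          - ∫ σ : ℝ, ((((2 * q - (x - σ) ^ 2) * (((x - σ) ^ 2 + q) ^ (5 / 2 : ℝ))⁻¹ : ℝ)) : ℂ) * ∫ y : ℝ, ((k (σ - y) : ℝ) : ℂ) * Y y)
        - ((w x : ℝ) : ℂ) * (∫ y : ℝ, ((k (x - y) : ℝ) : ℂ) * deriv Y y)
        + β₁ x * (∫ y : ℝ, ((k (x - y) : ℝ) : ℂ) * Y y) + β₂ x * conj (∫ y : ℝ, ((k (x - y) : ℝ) : ℂ) * Y y)‖ ^ 2) ^ (1 / 2 : ℝ)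
      ≤ (∫ t, |k t|) * (∫ y : ℝ, ‖I * (G : ℂ) * ((2 / q : ℂ) * Y y
              - ∫ σ : ℝ, ((((2 * q - (y - σ) ^ 2) * (((y - σ) ^ 2 + q) ^ (5 / 2 : ℝ))⁻¹ : ℝ)) : ℂ) * Y σ)
            - ((w y : ℝ) : ℂ) * deriv Y y + β₁ y * Y y + β₂ y * conj (Y y)‖ ^ 2) ^ (1 / 2 : ℝ)
        + (Λ * ((∫ t, |t| * |k' t|) + ∫ t, |k t|) + (L₁ + L₂) * ∫ t, |t| * |k t|) * (∫ y : ℝ, ‖Y y‖ ^ 2) ^ (1 / 2 : ℝ) := by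
  have hkc : Continuous k := continuous_iff_continuousAt.2 fun t => (hk t).continuousAt
  have hYc := hY.continuous
  have hY'c : Continuous (deriv Y) := hY.continuous_deriv le_rfl
  have hYd : ∀ y, HasDerivAt Y (deriv Y y) y := fun y => (hY.differentiable one_ne_zero y).hasDerivAt
  have hΛ0 : 0 ≤ Λ := (abs_nonneg _).trans (hΛ 0)
  -- the four functions
  set LY : ℝ → ℂ := fun y => I * (G : ℂ) * ((2 / q : ℂ) * Y y
      - ∫ σ : ℝ, ((((2 * q - (y - σ) ^ 2) * (((y - σ) ^ 2 + q) ^ (5 / 2 : ℝ))⁻¹ : ℝ)) : ℂ) * Y σ)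
      - ((w y : ℝ) : ℂ) * deriv Y y + β₁ y * Y y + β₂ y * conj (Y y) with hLY
  set A : ℝ → ℂ := fun x => ∫ y : ℝ, ((k (x - y) : ℝ) : ℂ) * LY y with hA
  set T : ℝ → ℂ := fun x => ∫ y, ((k (x - y) * (w y - w x) : ℝ) : ℂ) * deriv Y y with hT
  set M1 : ℝ → ℂ := fun x => ∫ y, ((k (x - y) : ℝ) : ℂ) * (β₁ y - β₁ x) * Y y with hM1
  set M2 : ℝ → ℂ := fun x => ∫ y, ((k (x - y) : ℝ) : ℂ) * (β₂ y - β₂ x) * conj (Y y) with hM2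
  -- the piece operator equals `A + T − M1 − M2` pointwise
  have hid : ∀ x : ℝ, I * (G : ℂ) * ((2 / q : ℂ) * (∫ y : ℝ, ((k (x - y) : ℝ) : ℂ) * Y y)
          - ∫ σ : ℝ, ((((2 * q - (x - σ) ^ 2) * (((x - σ) ^ 2 + q) ^ (5 / 2 : ℝ))⁻¹ : ℝ)) : ℂ) * ∫ y : ℝ, ((k (σ - y) : ℝ) : ℂ) * Y y)
        - ((w x : ℝ) : ℂ) * (∫ y : ℝ, ((k (x - y) : ℝ) : ℂ) * deriv Y y)
        + β₁ x * (∫ y : ℝ, ((k (x - y) : ℝ) : ℂ) * Y y) + β₂ x * conj (∫ y : ℝ, ((k (x - y) : ℝ) : ℂ) * Y y)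
      = ((A x + T x) - M1 x) - M2 x := by
    intro x
    have h := pieceOperator_eq (G := G) hq hkc hki hkM hY hYs hw.continuous hβ₁c.aestronglyMeasurable hβ₂c.aestronglyMeasurable hb₁ hb₂ x
    rw [h]
  simp_rw [hid]
  -- `L²` membership and bounds of the four pieces
  obtain ⟨MLY, hMLY⟩ := exists_bound_modelOperator hq G hY hYs hw.continuous hβ₁c hβ₂c
  have hLY2 : MemLp LY 2 volume := memLp_modelOperator hq G hY hYs hw.continuous hβ₁c hβ₂c hb₁ hb₂
  have hLYc : Continuous LY := continuous_modelOperator hq G hY hYs hw.continuous hβ₁c hβ₂c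
  obtain ⟨hA2, hAle⟩ := l2_kernel_mul_le hkc hki hLYc hLY2 hMLY
  obtain ⟨hT2, hTle⟩ := integral_sq_norm_transportCommutator_le hk hk'c hki hk'1 hw hΛ hYd hY'c hYs
  obtain ⟨hM12, hM1le⟩ := integral_sq_norm_multiplierCommutator_le hkc hk1 hβ₁c hL₁ hYc hYs
  obtain ⟨hM22, hM2le⟩ := integral_sq_norm_multiplierCommutator_le (f := fun y => conj (Y y)) hkc hk1 hβ₂c hL₂
    (Complex.continuous_conj.comp hYc) (hYs.comp_left (g := conj) (map_zero _))
  have hconj : ∫ y : ℝ, ‖conj (Y y)‖ ^ 2 = ∫ y : ℝ, ‖Y y‖ ^ 2 := by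
    refine integral_congr_ae (ae_of_all _ fun y => ?_); simp only [Complex.norm_conj]
  rw [hconj] at hM2le
  have hT' := l2_le_of_sq_le (f := Y) (by positivity) hTle
  have hL1 : 0 ≤ L₁ := by
    have := hL₁ 0 1; rw [sub_zero, abs_one, mul_one] at this; exact (norm_nonneg _).trans this
  have hL2 : 0 ≤ L₂ := by
    have := hL₂ 0 1; rw [sub_zero, abs_one, mul_one] at this; exact (norm_nonneg _).trans this
  have h1 : 0 ≤ ∫ t, |t| * |k t| := integral_nonneg fun t => by positivity
  have hM1' := l2_le_of_sq_le (f := Y) (mul_nonneg hL1 h1) hM1le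
  have hM2' := l2_le_of_sq_le (f := Y) (mul_nonneg hL2 h1) hM2le
  -- Minkowski thrice
  calc (∫ x : ℝ, ‖((A x + T x) - M1 x) - M2 x‖ ^ 2) ^ (1 / 2 : ℝ)
      ≤ (∫ x : ℝ, ‖(A x + T x) - M1 x‖ ^ 2) ^ (1 / 2 : ℝ) + (∫ x : ℝ, ‖M2 x‖ ^ 2) ^ (1 / 2 : ℝ) := l2_sub_le ((hA2.add hT2).sub hM12) hM22
    _ ≤ ((∫ x : ℝ, ‖A x + T x‖ ^ 2) ^ (1 / 2 : ℝ) + (∫ x : ℝ, ‖M1 x‖ ^ 2) ^ (1 / 2 : ℝ)) + (∫ x : ℝ, ‖M2 x‖ ^ 2) ^ (1 / 2 : ℝ) := by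
        gcongr; exact l2_sub_le (hA2.add hT2) hM12
    _ ≤ (((∫ x : ℝ, ‖A x‖ ^ 2) ^ (1 / 2 : ℝ) + (∫ x : ℝ, ‖T x‖ ^ 2) ^ (1 / 2 : ℝ)) + (∫ x : ℝ, ‖M1 x‖ ^ 2) ^ (1 / 2 : ℝ))
          + (∫ x : ℝ, ‖M2 x‖ ^ 2) ^ (1 / 2 : ℝ) := by
        gcongr; exact l2_add_le hA2 hT2
    _ ≤ ((∫ t, |k t|) * (∫ y : ℝ, ‖LY y‖ ^ 2) ^ (1 / 2 : ℝ)
          + Λ * ((∫ t, |t| * |k' t|) + ∫ t, |k t|) * (∫ y : ℝ, ‖Y y‖ ^ 2) ^ (1 / 2 : ℝ))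
          + L₁ * (∫ t, |t| * |k t|) * (∫ y : ℝ, ‖Y y‖ ^ 2) ^ (1 / 2 : ℝ)
          + L₂ * (∫ t, |t| * |k t|) * (∫ y : ℝ, ‖Y y‖ ^ 2) ^ (1 / 2 : ℝ) := by
        gcongr
    _ = _ := by ring

end Summit.NavierStokesRegularity.NavierStokesRegularity.Theorems.MatchedKernel

end
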